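import Mathlib
import Literature.Combinatorics.Additive.LinearVosper
import Literature.Combinatorics.Additive.LinearKneserProofs
import HarnessLib

/-!
# The linear Cauchy–Davenport inequality — discharge of `LinearCauchyDavenport`

Topic `Literature/Combinatorics/Additive`. Discharge of the named fact
`Literature.Combinatorics.Additive.LinearCauchyDavenport` (`LinearVosper.lean`): C. Bachoc,
O. Serra, G. Zémor, *An analogue of Vosper's theorem for extension fields*, Math. Proc. Cambridge
Philos. Soc. 163 (2017) = arXiv:1501.00602 [BachocSerraZemor2017], **Theorem 2** (p. 2, credited
to Eliahou–Lecouvey): if `L/F` has no proper finite intermediate extension then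
`dim(ST) ≥ min{dim L, dim S + dim T - 1}` for non-zero finite-dimensional `S, T ⊆ L`.

Proof as indicated in the paragraph preceding Theorem 2 (loc. cit. p. 2): by the linear Kneser
theorem (`Literature.Combinatorics.Additive.LinearKneser_holds`, stabiliser form
`dim ST + dim H(ST) ≥ dim S + dim T`) it suffices to note that the stabiliser `H(ST)` is an
intermediate field, finite-dimensional over `F` (`LinKneser.stabField`,
`LinKneser.finiteDimensional_mulStabilizer`), hence by hypothesis `H(ST) = F` — and then
`dim H(ST) = 1` — or `H(ST) = L` — and then `ST`, a non-zero `L`-subspace of `L`, is `L`.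

This file RESTORES the three declarations of the proposal p48288 (seat
`…Combinatorics.Additive.Linear-62a30762f4-0`, file `LinearVosperProofs.lean`), which the
whole-file proposal p50300 of `LinearVosperProofs.lean` (discharge of `LinearVosperAlgClosed`)
inadvertently replaced; names, signatures and citations are those recorded for p48288, the proofs
are re-derived.
-/

namespace Literature.Combinatorics.Additive

open Module

namespace LinKneser

variable {F L : Type*} [Field F] [Field L] [Algebra F L]

/-- If the stabiliser field `H(X)` is `F` then `dim_F H(X) = 1`.
[cite: BachocSerraZemor2017, paragraph preceding Thm 2 (p. 2)] -/
theorem finrank_mulStabilizer_eq_one_of_stabField_eq_bot {X : Submodule F L}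
    [FiniteDimensional F X] (hK : stabField X = ⊥) : finrank F (mulStabilizer X) = 1 := by
  rw [← finrank_stabField, hK, IntermediateField.finrank_bot]

/-- If the stabiliser field `H(X)` of a non-zero subspace `X` is all of `L`, then `X = L`
(`X ∋ x ≠ 0` and `(l x⁻¹) x ∈ X` for every `l`).
[cite: BachocSerraZemor2017, paragraph preceding Thm 2 (p. 2)] -/
theorem eq_top_of_stabField_eq_top {X : Submodule F L} [FiniteDimensional F X] (hX : X ≠ ⊥)
    (hK : stabField X = ⊤) : X = ⊤ := by
  obtain ⟨x, hx, hx0⟩ := (Submodule.ne_bot_iff X).mp hX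
  rw [eq_top_iff]
  intro l _
  have hl : l * x⁻¹ ∈ stabField X := by
    rw [hK]
    exact IntermediateField.mem_top
  have h := (mem_stabField.mp hl) x hx
  rwa [mul_assoc, inv_mul_cancel₀ hx0, mul_one] at h

end LinKneser

/-- **Linear Cauchy–Davenport inequality** (Bachoc–Serra–Zémor 2017, Theorem 2; Eliahou–Lecouvey)
— discharge of the named fact `LinearCauchyDavenport`: if every intermediate field of `L/F`
finite-dimensional over `F` is `F` or `L`, then for non-zero finite-dimensional `S, T ⊆ L`,
`dim(ST) ≥ min{dim L, dim S + dim T - 1}`. From the linear Kneser theorem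
(`LinearKneser_holds`): the stabiliser `H(ST)` is a finite intermediate field, so `H(ST) = F`
(and Kneser's bound reads `dim ST ≥ dim S + dim T - 1`) or `H(ST) = L` (and `ST = L`).
[cite: BachocSerraZemor2017, Thm 2 and the paragraph preceding it (p. 2)] -/
theorem LinearCauchyDavenport_holds : LinearCauchyDavenport := by
  intro F L _ _ _ hnoint S T hS hT hSb hTb
  haveI := hS
  haveI := hT
  have hSTb : S * T ≠ ⊥ := by
    rw [Ne, Submodule.mul_eq_bot, not_or]
    exact ⟨hSb, hTb⟩
  haveI : FiniteDimensional F ↥(S * T) :=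
    Module.Finite.iff_fg.mpr ((Module.Finite.iff_fg.mp hS).mul (Module.Finite.iff_fg.mp hT))
  haveI : FiniteDimensional F (mulStabilizer (S * T)) :=
    LinKneser.finiteDimensional_mulStabilizer hSTb
  haveI : FiniteDimensional F (LinKneser.stabField (S * T)) :=
    Module.Finite.equiv (LinKneser.stabFieldEquiv (S * T)).symm
  have hkn := LinearKneser_holds F L S T hS hT hSb hTb
  rcases hnoint (LinKneser.stabField (S * T)) inferInstance with hbot | htop
  · rw [LinKneser.finrank_mulStabilizer_eq_one_of_stabField_eq_bot hbot] at hkn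
    refine min_le_of_right_le ?_
    rw [← Module.finrank_eq_rank]
    exact_mod_cast (by omega : finrank F S + finrank F T - 1 ≤ finrank F ↥(S * T))
  · refine min_le_of_left_le (le_of_eq ?_)
    rw [LinKneser.eq_top_of_stabField_eq_top hSTb htop]
    exact (rank_top (R := F) (M := L)).symm

end Literature.Combinatorics.Additive
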